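import Summits.PneNP.PneNP.Theorems.MonotoneSuffices.Negative.CubeBoundary

/-!
# Block-parity noise, planting one point per block, and the path-counting bound

Coordinates `Coord a β = Fin a × Option β`: `a` blocks, each with free positions `β` and one parity
slot `none`. The NOISE encoding `enc u` of `u : Fin a → β → Bool` stores the free bits verbatim and the
parity (`par`, an XOR-fold) of each block in its parity slot. PLANTING `plantUpTo t s x` raises position
`s j` of every block `j < t` to `1`. For an up-set `F` of the cube, the BAD event
`bad F = {(u, s) | enc u ∉ F, plantUpTo a s (enc u) ∈ F}` is controlled by path counting over the
first-entrance time (`stepSet`): while planting block `j` one enters `F` only through the LOWER endpoint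
of a boundary edge of `F` in the uniformly random planted direction, and the partially planted sample is
determined by its image up to the `j` forgotten noise bits under the earlier planted positions
(`card_fiber_le`), whence `|β| · #bad F ≤ 2^a · |β|^a · bdry F` (`card_bad_mul_le`).

Part of the negative-side lemma `monotoneSuffices_false_without_productNoise` for the crux
`Summit.PneNP.PneNP.Theses.KarlinRubin.MonotoneSuffices` (stmt-PneNP-18026, route PneNP/KarlinRubin):
the OR-channel (stochastic-order) generalisation of the crux is false — see
`Summits/PneNP/PneNP/Theorems/MonotoneSuffices/Negative/ORChannel.lean` for the statement, the witness
and the discussion. Everything here is proved (no named facts). Refuter seat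
refuter-cdisprove-stmt-PneNP-18026-0 (cdisprove, cycle 1), 2026-08-17.
-/

set_option linter.dupNamespace false -- `Summit.PneNP.PneNP.…`: summit = sub-problem name (D-0017 single-conjunct layout)

namespace Summit.PneNP.PneNP.Theorems.MonotoneSuffices.Negative

open Finset Function

section Blocks

variable {a : ℕ} {β : Type*}

/-- Coordinates: block index × (a free position of the block, or its parity slot `none`). [folklore] -/
abbrev Coord (a : ℕ) (β : Type*) := Fin a × Option β

/-- Parity of a block (XOR-fold over the canonical enumeration of `β`). [folklore] -/
noncomputable def par [Fintype β] (v : β → Bool) : Bool :=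
  (univ : Finset β).toList.foldr (fun i acc => xor (v i) acc) false

/-- The noise encoding: free bits verbatim, the parity slot of each block carries its parity. [folklore] -/
noncomputable def enc [Fintype β] (u : Fin a → β → Bool) : Coord a β → Bool
  | (j, some i) => u j i
  | (j, none) => par (u j)

/-- Free bits are stored verbatim. [folklore] -/
@[simp] theorem enc_some [Fintype β] (u : Fin a → β → Bool) (j : Fin a) (i : β) :
    enc u (j, some i) = u j i := rfl

/-- The parity slot stores the block parity. [folklore] -/
@[simp] theorem enc_none [Fintype β] (u : Fin a → β → Bool) (j : Fin a) :
    enc u (j, none) = par (u j) := rfl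

/-- Plant a `1` at position `s j` of every block `j < t` (the first `t` blocks). [folklore] -/
def plantUpTo [DecidableEq β] (t : ℕ) (s : Fin a → β) (x : Coord a β → Bool) : Coord a β → Bool :=
  fun c => x c || decide ((c.1 : ℕ) < t ∧ c.2 = some (s c.1))

/-- Planting no block is the identity. [folklore] -/
theorem plantUpTo_zero [DecidableEq β] (s : Fin a → β) (x : Coord a β → Bool) :
    plantUpTo 0 s x = x := by
  funext c
  simp [plantUpTo]

/-- Planting only raises bits. [folklore] -/
theorem le_plantUpTo [DecidableEq β] (t : ℕ) (s : Fin a → β) (x : Coord a β → Bool) :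
    x ≤ plantUpTo t s x :=
  fun c => by unfold plantUpTo; exact Bool.left_le_or _ _

/-- Planting block `j` after the first `j` blocks is one cube step up at `(j, s j)`. [folklore] -/
theorem plantUpTo_succ [DecidableEq β] (j : Fin a) (s : Fin a → β) (x : Coord a β → Bool) :
    plantUpTo (j + 1) s x = update (plantUpTo j s x) (j, some (s j)) true := by
  funext c
  by_cases hc : c = (j, some (s j))
  · subst hc
    simp [plantUpTo]
  · rw [update_of_ne hc]
    unfold plantUpTo
    obtain ⟨j', o⟩ := c
    have hiff : ((j' : ℕ) < j + 1 ∧ o = some (s j')) ↔ ((j' : ℕ) < j ∧ o = some (s j')) := by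
      constructor
      · rintro ⟨h1, h2⟩
        refine ⟨?_, h2⟩
        rcases Nat.lt_succ_iff_lt_or_eq.1 h1 with h | h
        · exact h
        · exfalso
          apply hc
          have hj : j' = j := Fin.ext h
          subst hj
          rw [h2]
      · rintro ⟨h1, h2⟩
        exact ⟨Nat.lt_succ_of_lt h1, h2⟩
    simp only [hiff]

variable [Fintype β] [DecidableEq β] (F : Finset (Coord a β → Bool))

/-- The sample space: noise bits `u` and planted positions `s`, uniformly. [folklore] -/
abbrev Ω (a : ℕ) (β : Type*) := (Fin a → β → Bool) × (Fin a → β)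

/-- The BAD event for an up-set `F`: the noise is rejected but the planted input is accepted. [folklore] -/
noncomputable def bad : Finset (Ω a β) :=
  univ.filter fun p => enc p.1 ∉ F ∧ plantUpTo a p.2 (enc p.1) ∈ F

/-- First entrance into `F` happens while planting block `j`. [folklore] -/
noncomputable def stepSet (j : Fin a) : Finset (Ω a β) :=
  univ.filter fun p => plantUpTo j p.2 (enc p.1) ∉ F ∧ plantUpTo (j + 1) p.2 (enc p.1) ∈ F

/-- Every BAD sample enters `F` for the first time while planting some block `j`. [folklore] -/
theorem bad_subset_biUnion : bad F ⊆ univ.biUnion (stepSet F) := by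
  classical
  intro p hp
  simp only [bad, mem_filter, mem_univ, true_and] at hp
  obtain ⟨h0, ha⟩ := hp
  have hex : ∃ t, plantUpTo t p.2 (enc p.1) ∈ F := ⟨a, ha⟩
  have hspec : plantUpTo (Nat.find hex) p.2 (enc p.1) ∈ F := Nat.find_spec hex
  have hle : Nat.find hex ≤ a := Nat.find_min' hex ha
  have hne : Nat.find hex ≠ 0 := by
    intro h
    rw [h, plantUpTo_zero] at hspec
    exact h0 hspec
  have ht : Nat.find hex = (Nat.find hex - 1) + 1 := by omega
  have htF : plantUpTo (Nat.find hex - 1) p.2 (enc p.1) ∉ F := Nat.find_min hex (by omega)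
  rw [ht] at hspec
  simp only [mem_biUnion, mem_univ, true_and]
  refine ⟨⟨Nat.find hex - 1, by omega⟩, ?_⟩
  simp only [stepSet, mem_filter, mem_univ, true_and]
  exact ⟨htF, hspec⟩

/-- Union bound over the first-entrance time. [folklore] -/
theorem card_bad_le_sum : (bad F).card ≤ ∑ j : Fin a, (stepSet F j).card :=
  (card_le_card (bad_subset_biUnion F)).trans card_biUnion_le

/-- The projection used to count `stepSet F j`: forget the noise bits under the first `j`
planted positions. [folklore] -/
noncomputable def proj (j : Fin a) (p : Ω a β) : (Coord a β → Bool) × (Fin a → β) :=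
  (plantUpTo j p.2 (enc p.1), p.2)

/-- The block index of the `k`-th earlier block. [folklore] -/
def blk (j : Fin a) (k : Fin j) : Fin a := ⟨k, lt_trans k.2 j.2⟩

/-- The forgotten bits. [folklore] -/
def lost (j : Fin a) (p : Ω a β) : Fin j → Bool := fun k => p.1 (blk j k) (p.2 (blk j k))

omit [Fintype β] [DecidableEq β] in
/-- Unfolding `lost`. [folklore] -/
theorem lost_apply (j : Fin a) (p : Ω a β) (k : Fin j) : lost j p k = p.1 (blk j k) (p.2 (blk j k)) := rfl

/-- A sample is determined by its projection and its forgotten bits. [folklore] -/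
theorem proj_lost_injective (j : Fin a) {p p' : Ω a β} (hπ : proj j p = proj j p')
    (hl : lost j p = lost j p') : p = p' := by
  obtain ⟨u, s⟩ := p
  obtain ⟨u', s'⟩ := p'
  simp only [proj, Prod.mk.injEq] at hπ
  obtain ⟨hy, rfl⟩ := hπ
  refine Prod.ext ?_ rfl
  funext j' i
  have hc := congrFun hy (j', some i)
  simp only [plantUpTo, enc_some] at hc
  by_cases h : (j' : ℕ) < j ∧ i = s j'
  · obtain ⟨h1, rfl⟩ := h
    have hk := congrFun hl ⟨j', h1⟩
    simp only [lost_apply, blk] at hk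
    have hj : (⟨(j' : ℕ), lt_trans h1 j.2⟩ : Fin a) = j' := Fin.ext rfl
    rw [hj] at hk
    exact hk
  · have hfalse : decide ((j' : ℕ) < j ∧ some i = some (s j')) = false := by
      rw [decide_eq_false_iff_not]
      rintro ⟨h1, h2⟩
      exact h ⟨h1, Option.some_inj.1 h2⟩
    rw [hfalse, Bool.or_false, Bool.or_false] at hc
    exact hc

/-- Fibres of `proj j` on `stepSet F j` have at most `2^j` elements. [folklore] -/
theorem card_fiber_le (j : Fin a) (q : (Coord a β → Bool) × (Fin a → β)) :
    ((stepSet F j).filter fun p => proj j p = q).card ≤ 2 ^ (j : ℕ) := by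
  have hinj : Set.InjOn (lost (β := β) j)
      ((((stepSet F j).filter fun p => proj j p = q : Finset (Ω a β))) : Set (Ω a β)) := by
    intro p hp p' hp' hl
    have hq : proj j p = q := (mem_filter.1 (mem_coe.1 hp)).2
    have hq' : proj j p' = q := (mem_filter.1 (mem_coe.1 hp')).2
    exact proj_lost_injective j (hq.trans hq'.symm) hl
  have h := Finset.card_le_card_of_injOn (lost j) (fun p _ => mem_univ (lost j p)) hinj
  simpa [Fintype.card_fun] using h

/-- The image of `stepSet F j` under `proj j` consists of lower boundary points in direction
`(j, s j)`. [folklore] -/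
theorem proj_mem (j : Fin a) {p : Ω a β} (hp : p ∈ stepSet F j) :
    (proj j p).1 ∈ lowerBdry F (j, some ((proj j p).2 j)) := by
  simp only [stepSet, mem_filter, mem_univ, true_and] at hp
  obtain ⟨hno, hyes⟩ := hp
  rw [plantUpTo_succ] at hyes
  simp only [proj, lowerBdry, mem_filter, mem_univ, true_and]
  refine ⟨hno, ?_, hyes⟩
  by_contra hne
  have htrue : plantUpTo j p.2 (enc p.1) (j, some (p.2 j)) = true := by
    cases h : plantUpTo j p.2 (enc p.1) (j, some (p.2 j))
    · exact absurd h hne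
    · rfl
  rw [← htrue, update_eq_self] at hyes
  exact hno hyes

/-- Counting the first entrances while planting block `j`:
`b · #stepSet_j ≤ 2^j · b^a · ∑_i #lowerBdry F (j, i)` (`b = |β|`). [folklore] -/
theorem card_stepSet_mul_le (j : Fin a) :
    Fintype.card β * (stepSet F j).card ≤
      2 ^ (j : ℕ) * Fintype.card β ^ a * ∑ i : β, (lowerBdry F (j, some i)).card := by
  classical
  -- (1) fibres of `proj j` have size ≤ 2^j
  have h1 : (stepSet F j).card ≤ 2 ^ (j : ℕ) * ((stepSet F j).image (proj j)).card :=
    card_le_mul_card_image _ _ fun q _ => card_fiber_le F j q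
  -- (2) the image lies in the union over `s` of the boundary sets
  set T : Finset ((Coord a β → Bool) × (Fin a → β)) :=
    univ.biUnion fun s : Fin a → β => (lowerBdry F (j, some (s j))).map
      ⟨fun y => (y, s), fun y y' h => (Prod.mk.injEq _ _ _ _ ▸ h).1⟩ with hT
  have h2 : (stepSet F j).image (proj j) ⊆ T := by
    intro q hq
    obtain ⟨p, hp, rfl⟩ := mem_image.1 hq
    rw [hT, mem_biUnion]
    refine ⟨(proj j p).2, mem_univ _, ?_⟩
    rw [Finset.mem_map]
    exact ⟨(proj j p).1, proj_mem F j hp, rfl⟩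
  have h3 : T.card ≤ ∑ s : Fin a → β, (lowerBdry F (j, some (s j))).card := by
    rw [hT]
    refine card_biUnion_le.trans ?_
    simp
  -- (3) `b · ∑_s g (s j) = b^a · ∑_i g i`
  have h4 : Fintype.card β * ∑ s : Fin a → β, (lowerBdry F (j, some (s j))).card =
      Fintype.card β ^ a * ∑ i : β, (lowerBdry F (j, some i)).card := by
    set e := Equiv.piSplitAt j (fun _ : Fin a => β) with he
    have hs : ∑ s : Fin a → β, (lowerBdry F (j, some (s j))).card =
        ∑ q : β × ({k : Fin a // k ≠ j} → β), (lowerBdry F (j, some q.1)).card := by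
      refine Fintype.sum_equiv e _ _ fun s => ?_
      rfl
    rw [hs, Fintype.sum_prod_type]
    simp only [sum_const, card_univ, smul_eq_mul]
    have hcard : Fintype.card β * Fintype.card ({k : Fin a // k ≠ j} → β) = Fintype.card β ^ a := by
      rw [← Fintype.card_prod, ← Fintype.card_congr e, Fintype.card_fun, Fintype.card_fin]
    rw [← Finset.mul_sum, ← mul_assoc, hcard]
  calc Fintype.card β * (stepSet F j).card
      ≤ Fintype.card β * (2 ^ (j : ℕ) * ((stepSet F j).image (proj j)).card) :=
        Nat.mul_le_mul_left _ h1
    _ ≤ Fintype.card β * (2 ^ (j : ℕ) * ∑ s : Fin a → β, (lowerBdry F (j, some (s j))).card) :=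
        Nat.mul_le_mul_left _ (Nat.mul_le_mul_left _ ((card_le_card h2).trans h3))
    _ = 2 ^ (j : ℕ) * (Fintype.card β * ∑ s : Fin a → β, (lowerBdry F (j, some (s j))).card) := by
        ring
    _ = 2 ^ (j : ℕ) * Fintype.card β ^ a * ∑ i : β, (lowerBdry F (j, some i)).card := by
        rw [h4, mul_assoc]

/-- **The path-counting bound**: `b · #bad ≤ 2^a · b^a · bdry F`. [folklore] -/
theorem card_bad_mul_le : Fintype.card β * (bad F).card ≤ 2 ^ a * Fintype.card β ^ a * bdry F := by
  have hsum : ∑ j : Fin a, ∑ i : β, (lowerBdry F (j, some i)).card ≤ bdry F := by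
    unfold bdry
    rw [Fintype.sum_prod_type]
    refine Finset.sum_le_sum fun j _ => ?_
    rw [Fintype.sum_option]
    exact Nat.le_add_left _ _
  calc Fintype.card β * (bad F).card ≤ Fintype.card β * ∑ j : Fin a, (stepSet F j).card :=
        Nat.mul_le_mul_left _ (card_bad_le_sum F)
    _ = ∑ j : Fin a, Fintype.card β * (stepSet F j).card := Finset.mul_sum _ _ _
    _ ≤ ∑ j : Fin a, 2 ^ (j : ℕ) * Fintype.card β ^ a * ∑ i : β, (lowerBdry F (j, some i)).card :=
        Finset.sum_le_sum fun j _ => card_stepSet_mul_le F j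
    _ ≤ ∑ j : Fin a, 2 ^ a * Fintype.card β ^ a * ∑ i : β, (lowerBdry F (j, some i)).card := by
        refine Finset.sum_le_sum fun j _ => ?_
        gcongr
        · norm_num
        · exact j.2.le
    _ = 2 ^ a * Fintype.card β ^ a * ∑ j : Fin a, ∑ i : β, (lowerBdry F (j, some i)).card := by
        rw [Finset.mul_sum]
    _ ≤ 2 ^ a * Fintype.card β ^ a * bdry F := Nat.mul_le_mul_left _ hsum

/-- The size of the sample space and of the coordinate set. [folklore] -/
theorem card_Ω : Fintype.card (Ω a β) = (2 ^ Fintype.card β) ^ a * Fintype.card β ^ a := by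
  rw [Fintype.card_prod, Fintype.card_fun, Fintype.card_fun, Fintype.card_fun, Fintype.card_bool,
    Fintype.card_fin]

omit [DecidableEq β] in
/-- `N = a(|β|+1)` coordinates. [folklore] -/
theorem card_Coord : Fintype.card (Coord a β) = a * (Fintype.card β + 1) := by
  rw [Fintype.card_prod, Fintype.card_fin, Fintype.card_option]

end Blocks

end Summit.PneNP.PneNP.Theorems.MonotoneSuffices.Negative
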